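import Literature.Analysis.FluidPDE.LFourPressureGronwall
import Literature.Analysis.FluidPDE.PressureGradientExponents
import Literature.Analysis.FluidPDE.TaoPatchPressureTransfer
import Literature.Analysis.FluidPDE.GradientRegularityCriteriaProofs
import Literature.Analysis.FluidPDE.LerayHopfBoundedContinuation
import HarnessLib

/-!
# The pressure-gradient regularity criterion on `ℝ³`, case `1 < q < 3` (Lemarié-Rieusset, Prop. 11.7)

Analysis/FluidPDE proof file (theorems only: no definition, no named fact, no `sorry`).
Search for candidate a priori estimates; no regularity claim. This file PROVES the half
`1 < q < 3` of the named fact `Literature.Analysis.FluidPDE.pressureGradientCriterion`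
(`GradientRegularityCriteria`; Berselli–Galdi 2002 Thm. 3.3 / Zhou, as presented in
Lemarié-Rieusset 2016, §11.5 Prop. 11.7 with `σ = 2`): a classical solution of the unforced
Navier–Stokes system on `ℝ³ × [0, T)` which is Leray–Hopf from `u(0)` and whose pressure gradient
lies in `L^s(0, T; L^q)`, `2/s + 3/q = 3`, `1 < q < 3`, extends smoothly past `T`
(`pressureGradientCriterion_of_lt_three`). The case `q ≥ 3` of the fact (LR's `L^θ` energy with
`θ = 3q - 2`) is not covered; the fact itself therefore stays undischarged.

THE ARGUMENT (LR pp. 362–364, assembled on Tao's classical class exactly as the tree's discharges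
of the Serrin and Beirão da Veiga criteria, `NSSerrinRegularityProofs` /
`GradientRegularityCriteriaProofs`):
* Step A (`exists_lfour_le_of_pressureGradient`): on every open interval of `H¹`-regularity
  `(α, β) ⊆ (0, T)` the `L⁴` energy `∫|u(t)|⁴` stays bounded towards `β`. Locally in time the
  solution is represented by classical patches of Tao's `L²`-Sobolev class (`exists_tao_patch`); on
  a patch the pressure is the normalised pressure, so Stein's bound and the Sobolev bound
  `‖π‖_{L^r} ≤ K_q‖∇p‖_{L^q}`, `r = 3q/(3-q)`, hold (`ae_patch_pressure_bounds_of_le`,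
  `TaoPatchPressureTransfer`), and the `L⁴` Grönwall inequality `lfour_energy_le_mul_exp`
  (`LFourPressureGronwall`, from the slice estimate `LFourPressureSliceEstimate` = LR (11.47)–(11.50))
  propagates the bound; the exponentials chain along `[t₀, t]` (`forall_Icc_of_local_propagation`,
  `exp_lintegral_chain`), the total weight being `∫₀ᵀ ‖∇p‖_{L^q}^s < ∞`
  (`PressureGradientExponents`).
* Step B (`limsup_eH1NormSq_lt_top_of_lfour_bound_near`): a uniform `L⁴` bound near `β` puts a
  restart of `u` in the Serrin class `L⁸_t L⁴_x`, whence `limsup_{t→β⁻} ‖u(t)‖²_{H¹} < ∞` by the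
  tree's `limsup_eH1NormSq_lt_top_of_serrin` (RRS 2016, Lemma 8.16).
* Discharge: Leray's continuation (`leray_continuation_H1_holds`) gives `H¹`-regularity on
  `(0, T]`; Leray's local strong solution from a good time near `T`, made classical by
  Ladyzhenskaya–Prodi–Serrin and glued by weak–strong uniqueness, is the smooth extension past `T`.

## References

* [LemarieRieusset2016] P. G. Lemarié-Rieusset, *The Navier–Stokes problem in the 21st century*,
  CRC Press 2016 — §11.5 Prop. 11.7 and its proof (PDF pp. 362–364).
* [BerselliGaldi2002] L. C. Berselli, G. P. Galdi, *Regularity criteria involving the pressure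
  for the weak solutions to the Navier–Stokes equations*, Proc. AMS 130 (2002) 3585–3595 —
  Thm. 3.3 (p. 3593).
* [RobinsonRodrigoSadowski2016] J. C. Robinson, J. L. Rodrigo, W. Sadowski, *The
  three-dimensional Navier–Stokes equations*, CUP 2016 — Lemma 8.16, Thm. 8.17, Thm. 6.15.
-/

noncomputable section

open MeasureTheory Set Function Filter Topology InnerProductSpace
open scoped ENNReal NNReal ContDiff RealInnerProductSpace

namespace Literature.Analysis.FluidPDE

/-! ### Step A: the `L⁴` bound at the right end of an interval of regularity -/

section StepA

variable {ν T : ℝ} {u₀ : EuclideanSpace ℝ (Fin 3) → EuclideanSpace ℝ (Fin 3)}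
  {u : ℝ → EuclideanSpace ℝ (Fin 3) → EuclideanSpace ℝ (Fin 3)}
  {p : ℝ → EuclideanSpace ℝ (Fin 3) → ℝ}

/-- **Transfer of an a.e.-in-time property along a time translation** (Lebesgue measure on `ℝ`
is translation invariant, `measurePreserving_add_right`). [folklore] -/
private theorem ae_translate_right {P : ℝ → Prop} (h : ∀ᵐ σ ∂volume, P σ) (τ₁ : ℝ) :
    ∀ᵐ t ∂volume, P (t + τ₁) := by
  have hmp : MeasurePreserving (fun t : ℝ => t + τ₁) volume volume :=
    measurePreserving_add_right volume τ₁
  have h1 : ∀ᵐ y ∂(Measure.map (fun t : ℝ => t + τ₁) volume), P y := by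
    rw [hmp.map_eq]; exact h
  exact ae_of_ae_map hmp.measurable.aemeasurable h1

/-- **Uniform `L⁴` bound towards the right end of an interval of regularity, in the
pressure-gradient class `∇p ∈ L^s_t L^q_x`, `2/s + 3/q = 3`, `1 < q < 3`** (Lemarié-Rieusset 2016,
Prop. 11.7: "`sup_{0<t<T} ‖u(t)‖_θ < +∞`", case `θ = 4`; Berselli–Galdi 2002, Thm. 3.3). Let
`(u, p)` be a classical solution of the unforced system on `ℝ³ × [0, T)` which is Leray–Hopf on
`[0, T)`, with `∇p(σ) ∈ L^q` for a.e. `σ ∈ (0, T)` and finite time integral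
`Ā = ∫₀ᵀ ‖∇p‖_{L^q}^{s} < ∞`, `H¹`-regular on an open interval `(α, β) ⊆ (0, T)`, and `t₀ ∈ (α, β)`
with `u(t₀) ∈ L⁴`. Given Tao's local `H¹` theory (`TaoH1AlmostRegularWith c`, `c > 0`), for every
`t ∈ [t₀, β)`: `∫|u(t)|⁴ ≤ exp(C Ā) ∫|u(t₀)|⁴ < ∞` with
`C = C(θ,K)(8ν)^{-(1-Θ)/Θ} (C_S K_q)^{1/θ}`, `θ = 1 - 3/(2r)`, `r = 3q/(3-q)`, `1/θ = s`, `C_S`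
Stein's constant at exponent `m = 2r/(r-1)` and `K_q` the Sobolev constant of `W^{1,q} ⊂ L^r`.
Proof: the bound is continued along `[t₀, t]` by `forall_Icc_of_local_propagation`; near any `σ` a
classical patch from a good time just below `σ` (`exists_tao_patch`) carries `τ₁ ≤ τ₂`; on it the
slices of the patch EQUAL those of `u`, the patch pressure is the normalised pressure with
`‖π‖_{L^m} ≤ C_S‖w‖²_{L^{2m}}` and `‖π‖_{L^r} ≤ K_q‖∇p‖_{L^q}` (`ae_patch_pressure_bounds_of_le`),
and the `L⁴` Grönwall inequality on the translated slab (`lfour_energy_le_mul_exp`) bounds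
`∫|u(τ₂)|⁴` by `∫|u(τ₁)|⁴`; the exponentials chain (`exp_lintegral_chain`).
[cite: LemarieRieusset2016, §11.5 Prop. 11.7 (PDF pp. 362–364)] [cite: BerselliGaldi2002, Thm. 3.3] -/
theorem exists_lfour_le_of_pressureGradient {c : ℝ} (hL2 : TaoH1AlmostRegularWith c) (hc : 0 < c)
    (hν : 0 < ν) (hLH : IsLerayHopfOn T ν 0 u₀ u) (hcl : IsClassicalNSSolutionOn (Ico 0 T) ν 0 u p)
    {s q : ℝ≥0∞} (h1q : 1 < q) (hq3 : q < 3) (hsq : 2 / s + 3 / q = 3)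
    (hLq : ∀ᵐ σ ∂volume, σ ∈ Ioo 0 T → eLpNorm (fun x => gradient (p σ) x) q volume < ⊤)
    (hA : ∫⁻ t in Ioo 0 T, ENNReal.ofReal
      ((eLpNorm (fun x => gradient (p t) x) q volume).toReal ^ s.toReal) ≠ ⊤)
    {α β : ℝ} (hα : 0 ≤ α) (hβ : β ≤ T) (hreg : IsH1RegularOn (Ioo α β) u)
    {t₀ : ℝ} (ht₀ : t₀ ∈ Ioo α β) (hy₀ : ∫⁻ x, ENNReal.ofReal (‖u t₀ x‖ ^ (4 : ℝ)) < ⊤) :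
    ∃ K : ℝ≥0∞, K < ⊤ ∧ ∀ t ∈ Ico t₀ β, ∫⁻ x, ENNReal.ofReal (‖u t x‖ ^ (4 : ℝ)) ≤ K := by
  -- exponents (opaque names with defining equations, to keep definitional unfolding cheap)
  obtain ⟨hr32, hrtop, hstop, hs0, hsθ, hqr⟩ := pressureGradient_exponents h1q hq3 hsq
  obtain ⟨r, hr⟩ : ∃ r : ℝ≥0∞, r = ENNReal.ofReal (3 * q.toReal / (3 - q.toReal)) := ⟨_, rfl⟩
  rw [← hr] at hr32 hrtop hsθ hqr
  have hρ3 : 3 / 2 < r.toReal := by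
    have h : ((3 / 2 : ℝ≥0∞)).toReal < r.toReal :=
      (ENNReal.toReal_lt_toReal (ENNReal.div_ne_top (by norm_num) (by norm_num)) hrtop).2 hr32
    have h32 : ((3 / 2 : ℝ≥0∞)).toReal = 3 / 2 := by
      rw [ENNReal.toReal_div, ENNReal.toReal_ofNat, ENNReal.toReal_ofNat]
    rw [h32] at h
    exact h
  have hρ0 : 0 < r.toReal := by linarith
  have hρ1 : 0 < r.toReal - 1 := by linarith
  obtain ⟨θ, hθ⟩ : ∃ θ : ℝ, θ = 1 - 3 / (2 * r.toReal) := ⟨_, rfl⟩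
  obtain ⟨Θ, hΘ⟩ : ∃ Θ : ℝ, Θ = θ / 2 := ⟨_, rfl⟩
  have hθ0 : 0 < θ := by
    rw [hθ, sub_pos, div_lt_one (by positivity)]; linarith
  have hθ1 : θ < 1 := by
    rw [hθ]; linarith [div_pos (zero_lt_three' ℝ) (by positivity : (0 : ℝ) < 2 * r.toReal)]
  have hΘ0 : 0 < Θ := by rw [hΘ]; positivity
  have hΘ1 : Θ < 1 := by rw [hΘ]; linarith
  have hsθ' : s.toReal = 1 / θ := by rw [hθ]; exact hsθ
  -- the Stein exponent `m = 2ρ/(ρ-1) ∈ (2, 6)` and constant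
  obtain ⟨m, hm⟩ : ∃ m : ℝ, m = 2 * r.toReal / (r.toReal - 1) := ⟨_, rfl⟩
  have hm2 : 2 < m := by rw [hm, lt_div_iff₀ hρ1]; linarith
  obtain ⟨mE, hmE⟩ : ∃ mE : ℝ≥0∞, mE = ENNReal.ofReal m := ⟨_, rfl⟩
  have h1mE : 1 < mE := by
    rw [hmE, ← ENNReal.ofReal_one]; exact (ENNReal.ofReal_lt_ofReal_iff (by linarith)).2 (by linarith)
  have hmEtop : mE < ⊤ := by rw [hmE]; exact ENNReal.ofReal_lt_top
  have h2mE : ENNReal.ofReal (2 * m) = 2 * mE := by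
    rw [hmE, ENNReal.ofReal_mul (by norm_num : (0:ℝ) ≤ 2), ENNReal.ofReal_ofNat]
  obtain ⟨CS, hCS⟩ := exists_eLpNorm_normalisedPressure_le_sq (p := mE) h1mE hmEtop
  -- constants
  obtain ⟨Kq, hKq⟩ : ∃ Kq : ℝ≥0,
      Kq = SNormLESNormFDerivOfEqConst ℝ (volume : Measure (EuclideanSpace ℝ (Fin 3))) q.toReal :=
    ⟨_, rfl⟩
  obtain ⟨κ, hκ⟩ : ∃ κ : ℝ, κ = (Θ * (2 * (1 - Θ)) ^ ((1 - Θ) / Θ) *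
      (8 * (4 * (SNormLESNormFDerivOfEqConst ℝ (volume : Measure (EuclideanSpace ℝ (Fin 3))) 2 :
        ℝ) ^ 2) ^ ((1 - θ) / 2)) ^ (1 / Θ)) * (8 * ν) ^ (-((1 - Θ) / Θ)) := ⟨_, rfl⟩
  obtain ⟨κ', hκ'⟩ : ∃ κ' : ℝ, κ' = ((CS : ℝ) * Kq) ^ (1 / θ) := ⟨_, rfl⟩
  have hκ0 : 0 ≤ κ := by
    have : 0 ≤ 1 - Θ := by linarith
    rw [hκ]; positivity
  have hκ'0 : 0 ≤ κ' := by rw [hκ']; positivity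
  obtain ⟨Cν, hCν⟩ : ∃ Cν : ℝ, Cν = κ * κ' := ⟨_, rfl⟩
  have hCν0 : 0 ≤ Cν := by rw [hCν]; positivity
  -- the weight `a σ = ofReal (‖∇p σ‖_q ^ (1/θ))` and the `L⁴` energy `y`
  obtain ⟨N, hN⟩ : ∃ N : ℝ → ℝ,
      N = fun σ => (eLpNorm (fun x => gradient (p σ) x) q volume).toReal := ⟨_, rfl⟩
  have hN0 : ∀ σ, 0 ≤ N σ := fun σ => by rw [hN]; exact ENNReal.toReal_nonneg
  obtain ⟨a, ha⟩ : ∃ a : ℝ → ℝ≥0∞, a = fun σ => ENNReal.ofReal (N σ ^ (1 / θ)) := ⟨_, rfl⟩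
  have hA' : ∫⁻ t in Ioo 0 T, a t ≠ ⊤ := by
    rw [ha, hN]; simp only; rw [← hsθ']; exact hA
  obtain ⟨y, hy⟩ : ∃ y : ℝ → ℝ≥0∞, y = fun τ => ∫⁻ x, ENNReal.ofReal (‖u τ x‖ ^ (4 : ℝ)) :=
    ⟨_, rfl⟩
  obtain ⟨y₀, hy₀def⟩ : ∃ y₀ : ℝ≥0∞, y₀ = y t₀ := ⟨_, rfl⟩
  have hy₀top : y₀ < ⊤ := by rw [hy₀def, hy]; exact hy₀
  refine ⟨ENNReal.ofReal (Real.exp (Cν * (∫⁻ σ in Ioo 0 T, a σ).toReal)) * y₀,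
    ENNReal.mul_lt_top ENNReal.ofReal_lt_top hy₀top, fun t ht => ?_⟩
  have hyt : ∫⁻ x, ENNReal.ofReal (‖u t x‖ ^ (4 : ℝ)) = y t := by rw [hy]
  rw [hyt]
  have ht₀0 : 0 < t₀ := hα.trans_lt ht₀.1
  have htT : t < T := ht.2.trans_le hβ
  -- good restarting times
  have hgood : ∀ᵐ s' ∂(volume.restrict (Ioo 0 T)),
      IsLerayHopfOn (T - s') ν 0 (u s') (fun t => u (t + s')) := hLH.ae_isLerayHopfOn_restart hν.le
  -- a uniform `H¹` bound on the compact `[(α + t₀)/2, t]`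
  have hKsub : Icc ((α + t₀) / 2) t ⊆ Ioo α β := fun s' hs' =>
    ⟨lt_of_lt_of_le (by linarith [ht₀.1]) hs'.1, hs'.2.trans_lt ht.2⟩
  obtain ⟨M, hM, hbound⟩ := hreg.exists_forall_le isCompact_Icc hKsub
  set Am : ℝ := M.toReal with hAm
  have hAm0 : 0 ≤ Am := ENNReal.toReal_nonneg
  set τM : ℝ := c * ν ^ 3 / (Am ^ 2 + 1) with hτM
  have hτM0 : 0 < τM := by positivity
  have hτMc : Am ^ 2 * τM ≤ c * ν ^ 3 := by
    rw [hτM, mul_div_assoc']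
    rw [div_le_iff₀ (by positivity)]
    nlinarith [mul_pos hc (pow_pos hν 3)]
  -- the propagated property
  set A : ℝ → ℝ := fun τ => (∫⁻ σ in Ioo t₀ τ, a σ).toReal with hAdef
  set P : ℝ → Prop := fun τ => y τ ≤ ENNReal.ofReal (Real.exp (Cν * A τ)) * y₀ with hPdef
  have hPt : P t := by
    refine forall_Icc_of_local_propagation (a := t₀) (b := t) (P := P) ?_ ?_ t ⟨ht.1, le_rfl⟩
    · -- `P t₀`
      simp only [hPdef, hAdef, Ioo_self, Measure.restrict_empty, lintegral_zero_measure,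
        ENNReal.toReal_zero, mul_zero, Real.exp_zero, ENNReal.ofReal_one, one_mul, hy₀def, le_refl]
    · -- local propagation around `σ ∈ [t₀, t]`
      intro σ hσ
      have hσT : σ ≤ T := (hσ.2.trans ht.2.le).trans hβ
      -- a good time `s'` just below `σ`
      have hlo : 0 ≤ max ((α + t₀) / 2) (σ - τM / 2) := le_max_of_le_left (by linarith)
      have hlt : max ((α + t₀) / 2) (σ - τM / 2) < σ :=
        max_lt (by linarith [hσ.1, ht₀.1]) (by linarith)
      obtain ⟨s', hs', hLHs⟩ := exists_mem_Ioo_of_ae_restrict_Ioo hlo hlt hσT hgood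
      have hs1 : (α + t₀) / 2 < s' := (le_max_left _ _).trans_lt hs'.1
      have hs2 : σ - τM / 2 < s' := (le_max_right _ _).trans_lt hs'.1
      have hs0 : 0 < s' := lt_of_le_of_lt (by linarith) hs1
      have hsT : s' < T := hs'.2.trans_le hσT
      have hsK : s' ∈ Icc ((α + t₀) / 2) t := ⟨hs1.le, hs'.2.le.trans hσ.2⟩
      have hAs : eH1NormSq (u s') ≤ ENNReal.ofReal Am := by
        rw [hAm, ENNReal.ofReal_toReal hM.ne]; exact hbound s' hsK
      set τ' : ℝ := min τM (T - s') with hτ'def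
      refine ⟨min (σ - s') (τM / 2), lt_min (sub_pos.2 hs'.2) (by positivity), ?_⟩
      intro τ₁ hτ₁ τ₂ hτ₂ hτ₁σ hτ₁₂ hτ₂σ hP1
      rcases eq_or_lt_of_le hτ₁₂ with heq | hlt12
      · rw [← heq]; exact hP1
      -- the patch from `s'` covers `[τ₁, τ₂]`
      have hδ1 : min (σ - s') (τM / 2) ≤ σ - s' := min_le_left _ _
      have hδ2 : min (σ - s') (τM / 2) ≤ τM / 2 := min_le_right _ _
      have hsτ₁ : s' < τ₁ := by linarith
      have hτ₂T : τ₂ < T := lt_of_le_of_lt hτ₂.2 htT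
      have hτ₂τ' : τ₂ - s' < τ' := by
        refine lt_min (by linarith) ?_
        linarith [hτ₂.2, ht.2, hβ]
      set ε : ℝ := τ₁ - s' with hεdef
      have hε0 : 0 < ε := sub_pos.2 hsτ₁
      have hετ' : ε < τ' := lt_trans (by rw [hεdef]; linarith) hτ₂τ'
      obtain ⟨w, π, hw, hbw, hbwt, hbπ, hrep⟩ := exists_tao_patch hL2 hν hLH ⟨hs0, hsT⟩ hLHs hAm0
        hAs hτM0 hτMc (ε := ε) ⟨hε0, hετ'⟩
      -- translate to the slab `[0, τ' - ε]`, i.e. `u`-times `[τ₁, s' + τ']`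
      obtain ⟨hw', hbw', hbwt', hbπ'⟩ := taoSlab_translate hw hbw hbwt hbπ (e := ε) ⟨le_rfl, hετ'⟩
      have hL : 0 < τ' - ε := sub_pos.2 hετ'
      have hrep' : ∀ t' ∈ Icc 0 (τ' - ε), u (t' + τ₁) =ᵐ[volume] w (t' + ε) := by
        intro t' ht'
        have h := hrep (t' + ε) ⟨by linarith [ht'.1], by linarith [ht'.2]⟩
        have e1 : t' + ε + s' = t' + τ₁ := by rw [hεdef]; ring
        rwa [e1] at h
      have hs12 : τ₂ - τ₁ ∈ Ioc 0 (τ' - ε) := ⟨sub_pos.2 hlt12, by rw [hεdef]; linarith⟩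
      -- on `u`-times `< T` the slices of the patch EQUAL those of the classical `u`
      have hsub12 : Ioo τ₁ τ₂ ⊆ Ioo 0 T := Ioo_subset_Ioo (by linarith [hτ₁.1]) hτ₂T.le
      have hS' : ∀ t' ∈ Ioo 0 (τ₂ - τ₁), t' + τ₁ ∈ Ico 0 T := fun t' ht' =>
        ⟨by linarith [ht'.1, hτ₁.1, ht₀0], by linarith [ht'.2]⟩
      have heqw : ∀ t' ∈ Ioo 0 (τ₂ - τ₁), u (t' + τ₁) = (fun t => w (t + ε)) t' := by
        intro t' ht'
        have hcu : Continuous (u (t' + τ₁)) := (hcl.contDiff_velocity (hS' t' ht')).continuous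
        have hcw : Continuous (w (t' + ε)) :=
          (hw'.contDiff_velocity ⟨ht'.1.le, ht'.2.le.trans hs12.2⟩).continuous
        exact (Continuous.ae_eq_iff_eq volume hcu hcw).1 (hrep' t' ⟨ht'.1.le, ht'.2.le.trans hs12.2⟩)
      -- pressure bounds on the patch, a.e. on `(0, τ₂ - τ₁)`
      have hpb := ae_patch_pressure_bounds_of_le hν hL hw' hbw' (hbπ' 0) hcl hs12.2 hS' heqw
        h1mE hmEtop hCS h1q hq3 hrtop hqr
      -- the a.e. finiteness of `∇p` slices, translated
      have hLq' : ∀ᵐ t' ∂volume, t' ∈ Ioo 0 (τ₂ - τ₁) →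
          eLpNorm (fun x => gradient (p (t' + τ₁)) x) q volume < ⊤ := by
        filter_upwards [ae_translate_right hLq τ₁] with t' ht' ht'I
        exact ht' (hsub12 ⟨by linarith [ht'I.1], by linarith [ht'I.2]⟩)
      -- G's hypotheses on the patch
      have hLr' : ∀ᵐ t' ∂volume, t' ∈ Ioo 0 (τ₂ - τ₁) →
          eLpNorm (π (t' + ε)) r volume < ⊤ ∧
          eLpNorm (π (t' + ε)) (ENNReal.ofReal (2 * r.toReal / (r.toReal - 1))) volume ≤
            CS * eLpNorm (w (t' + ε)) (ENNReal.ofReal (2 * (2 * r.toReal / (r.toReal - 1)))) volume ^ 2 := by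
        filter_upwards [hpb, hLq'] with t' ht' hfin ht'I
        obtain ⟨hSt, hGNS⟩ := ht' ht'I
        refine ⟨lt_of_le_of_lt hGNS (ENNReal.mul_lt_top ENNReal.coe_lt_top (hfin ht'I)), ?_⟩
        rw [← hm, ← hmE, h2mE]
        exact hSt
      -- pointwise comparison of the weights
      have hwt : ∀ᵐ t' ∂volume, t' ∈ Ioo 0 (τ₂ - τ₁) →
          ENNReal.ofReal (((CS : ℝ) * (eLpNorm (π (t' + ε)) r volume).toReal) ^ (1 / θ)) ≤
            ENNReal.ofReal κ' * a (t' + τ₁) := by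
        filter_upwards [hpb, hLq'] with t' ht' hfin ht'I
        obtain ⟨-, hGNS⟩ := ht' ht'I
        rw [← hKq] at hGNS
        have hfinR : (Kq : ℝ≥0∞) * eLpNorm (fun x => gradient (p (t' + τ₁)) x) q volume ≠ ⊤ :=
          ENNReal.mul_ne_top ENNReal.coe_ne_top (hfin ht'I).ne
        have hreal : (eLpNorm (π (t' + ε)) r volume).toReal ≤ (Kq : ℝ) * N (t' + τ₁) := by
          have h := ENNReal.toReal_mono hfinR hGNS
          rw [ENNReal.toReal_mul, ENNReal.coe_toReal] at h
          rw [hN]; exact h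
        rw [ha]; simp only
        rw [← ENNReal.ofReal_mul hκ'0, hκ', ← Real.mul_rpow (by positivity) (hN0 _)]
        refine ENNReal.ofReal_le_ofReal (Real.rpow_le_rpow (by positivity) ?_ (by positivity))
        calc (CS : ℝ) * (eLpNorm (π (t' + ε)) r volume).toReal ≤ (CS : ℝ) * ((Kq : ℝ) * N (t' + τ₁)) :=
              mul_le_mul_of_nonneg_left hreal CS.coe_nonneg
          _ = (CS : ℝ) * Kq * N (t' + τ₁) := by ring
      have hint : ∫⁻ t' in Ioo 0 (τ₂ - τ₁),
          ENNReal.ofReal (((CS : ℝ) * (eLpNorm (π (t' + ε)) r volume).toReal) ^ (1 / θ)) ≤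
            ENNReal.ofReal κ' * ∫⁻ σ' in Ioo τ₁ τ₂, a σ' := by
        calc ∫⁻ t' in Ioo 0 (τ₂ - τ₁),
            ENNReal.ofReal (((CS : ℝ) * (eLpNorm (π (t' + ε)) r volume).toReal) ^ (1 / θ))
            ≤ ∫⁻ t' in Ioo 0 (τ₂ - τ₁), ENNReal.ofReal κ' * a (t' + τ₁) := by
              refine lintegral_mono_ae ((ae_restrict_iff' measurableSet_Ioo).2 ?_)
              filter_upwards [hwt] with t' ht' ht'I
              exact ht' ht'I
          _ = ENNReal.ofReal κ' * ∫⁻ t' in Ioo 0 (τ₂ - τ₁), a (t' + τ₁) :=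
              lintegral_const_mul' _ _ ENNReal.ofReal_ne_top
          _ = ENNReal.ofReal κ' * ∫⁻ σ' in Ioo τ₁ τ₂, a σ' := by
              rw [setLIntegral_Ioo_comp_add_right a 0 (τ₂ - τ₁) τ₁, zero_add, sub_add_cancel]
      have hfin12 : ∫⁻ σ' in Ioo τ₁ τ₂, a σ' ≠ ⊤ := ne_top_of_le_ne_top hA' (lintegral_mono_set hsub12)
      have hAfin : ∫⁻ t' in Ioo 0 (τ₂ - τ₁),
          ENNReal.ofReal (((CS : ℝ) * (eLpNorm (π (t' + ε)) r volume).toReal) ^ (1 / θ)) ≠ ⊤ :=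
        ne_top_of_le_ne_top (ENNReal.mul_ne_top ENNReal.ofReal_ne_top hfin12) hint
      -- the `L⁴` Grönwall inequality on the translated slab
      have hineq := lfour_energy_le_mul_exp hν hL hw' hbw' hbwt' hbπ' hr32 hrtop hθ hΘ hs12 hLr' hAfin
      -- identify the `L⁴` energies with those of `u`
      have hy2 : y τ₂ = ∫⁻ x, ENNReal.ofReal (‖w (τ₂ - τ₁ + ε) x‖ ^ (4 : ℝ)) := by
        rw [hy]
        refine lintegral_congr_ae ?_
        have h := hrep' (τ₂ - τ₁) ⟨hs12.1.le, hs12.2⟩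
        rw [sub_add_cancel] at h
        filter_upwards [h] with x hx
        rw [hx]
      have hy1 : y τ₁ = ∫⁻ x, ENNReal.ofReal (‖w (0 + ε) x‖ ^ (4 : ℝ)) := by
        rw [hy]
        refine lintegral_congr_ae ?_
        have h := hrep' 0 ⟨le_rfl, hL.le⟩
        rw [zero_add τ₁] at h
        filter_upwards [h] with x hx
        rw [hx]
      have hstep : y τ₂ ≤ ENNReal.ofReal (Real.exp (Cν * (∫⁻ σ' in Ioo τ₁ τ₂, a σ').toReal)) * y τ₁ := by
        rw [hy2, hy1]
        refine hineq.trans (mul_le_mul_left (ENNReal.ofReal_le_ofReal (Real.exp_le_exp.2 ?_)) _)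
        -- `κ * (∫ ofReal((CS‖π‖_r)^{1/θ})).toReal ≤ Cν * (∫ a).toReal`
        have h1 : (∫⁻ t' in Ioo 0 (τ₂ - τ₁), ENNReal.ofReal
            (((CS : ℝ) * (eLpNorm (π (t' + ε)) r volume).toReal) ^ (1 / θ))).toReal ≤
            κ' * (∫⁻ σ' in Ioo τ₁ τ₂, a σ').toReal := by
          have h := ENNReal.toReal_mono (ENNReal.mul_ne_top ENNReal.ofReal_ne_top hfin12) hint
          rwa [ENNReal.toReal_mul, ENNReal.toReal_ofReal hκ'0] at h
        have h2 := mul_le_mul_of_nonneg_left h1 hκ0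
        rw [hκ] at h2
        refine h2.trans_eq ?_
        rw [hCν, hκ]; ring
      have hfin02 : ∫⁻ σ' in Ioo t₀ τ₂, a σ' ≠ ⊤ :=
        ne_top_of_le_ne_top hA' (lintegral_mono_set (Ioo_subset_Ioo ht₀0.le hτ₂T.le))
      exact exp_lintegral_chain (y := y) (a := a) (C := Cν) (y₀ := y₀) hτ₁.1 hτ₁₂ hfin02 hP1 hstep
  -- conclusion
  refine hPt.trans (mul_le_mul_left (ENNReal.ofReal_le_ofReal (Real.exp_le_exp.2
    (mul_le_mul_of_nonneg_left ?_ hCν0))) _)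
  exact ENNReal.toReal_mono hA' (lintegral_mono_set (Ioo_subset_Ioo ht₀0.le htT.le))

end StepA

/-! ### Step B: the continuation hypothesis from a uniform `L⁴` bound -/

section StepB

variable {ν T : ℝ} {u₀ : EuclideanSpace ℝ (Fin 3) → EuclideanSpace ℝ (Fin 3)}
  {u : ℝ → EuclideanSpace ℝ (Fin 3) → EuclideanSpace ℝ (Fin 3)}

/-- **An `H¹ ∩ L²` field is in `L⁴`** (Lebesgue interpolation between `L²` and `L⁶` and the
Sobolev inequality for the weak gradient): if `v ∈ L²(ℝ³)` and `‖v‖²_{H¹} < ∞` then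
`∫ |v|⁴ < ∞`. [folklore] -/
private theorem lintegral_lfour_lt_top_of_eH1NormSq_lt_top
    {v : EuclideanSpace ℝ (Fin 3) → EuclideanSpace ℝ (Fin 3)} (hv2 : MemLp v 2 volume)
    (hH : eH1NormSq v < ⊤) : ∫⁻ x, ENNReal.ofReal (‖v x‖ ^ (4 : ℝ)) < ⊤ := by
  have hlt : eH1NormSq v < eH1NormSq v + 1 := ENNReal.lt_add_right hH.ne one_ne_zero
  obtain ⟨G, hG, hGlt⟩ := exists_hasWeakGradient_of_eH1NormSq_lt hlt
  have h6 : eLpNorm v 6 volume < ⊤ := by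
    refine lt_of_le_of_lt (eLpNorm_six_le_lintegral_frobeniusNormSq_weakGradient
      finrank_euclideanSpace_fin hG hv2.eLpNorm_lt_top) (ENNReal.mul_lt_top ENNReal.coe_lt_top ?_)
    refine ENNReal.rpow_lt_top_of_nonneg (by norm_num) (lt_of_le_of_lt le_add_self
      (hGlt.trans (ENNReal.add_lt_top.2 ⟨hH, ENNReal.one_lt_top⟩))).ne
  have h2 : ∫⁻ x, ‖v x‖ₑ ^ (2 : ℝ) < ⊤ := by
    have h := hv2.eLpNorm_lt_top
    rw [eLpNorm_lt_top_iff_lintegral_rpow_enorm_lt_top two_ne_zero (by simp)] at h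
    simpa using h
  have h6' : ∫⁻ x, ‖v x‖ₑ ^ (6 : ℝ) < ⊤ := by
    rw [eLpNorm_lt_top_iff_lintegral_rpow_enorm_lt_top (by norm_num) (by simp)] at h6
    have e6 : (6 : ℝ≥0∞).toReal = 6 := by norm_num
    rw [e6] at h6
    exact h6
  have hint := lintegral_rpow_interpolate hv2.1.aemeasurable.enorm (a := 2) (b := 6) (r := 4)
    zero_lt_two (by norm_num) (by norm_num) (by norm_num)
  have hconv : ∫⁻ x, ENNReal.ofReal (‖v x‖ ^ (4 : ℝ)) = ∫⁻ x, ‖v x‖ₑ ^ (4 : ℝ) :=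
    lintegral_congr fun x => by
      rw [← ofReal_norm, ENNReal.ofReal_rpow_of_nonneg (norm_nonneg _) (by norm_num)]
  rw [hconv]
  refine lt_of_le_of_lt hint (ENNReal.mul_lt_top ?_ ?_)
  · exact ENNReal.rpow_lt_top_of_nonneg (by norm_num) h2.ne
  · exact ENNReal.rpow_lt_top_of_nonneg (by norm_num) h6'.ne

/-- **The Serrin integral `∫‖u‖_{L⁴}^8` of a translate with bounded `L⁴` energy is finite**: if
`∫|u(t + s)|⁴ ≤ K < ∞` for `t ∈ (0, L)` then `∫₀ᴸ ‖u(t + s)‖_{L⁴}^{2/(1-3/4)} dt < ∞`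
(`2/(1-3/4) = 8`, the Serrin pair `(8, 4)`). [folklore] -/
private theorem lintegral_serrin_four_ne_top_of_lfour_bound {s L : ℝ} {K : ℝ≥0∞} (hK : K < ⊤)
    (hbd : ∀ t ∈ Ioo 0 L, ∫⁻ x, ENNReal.ofReal (‖u (t + s) x‖ ^ (4 : ℝ)) ≤ K) :
    ∫⁻ t in Ioo 0 L, ENNReal.ofReal ((eLpNorm (u (t + s)) 4 volume).toReal ^
      (2 / (1 - (3 / (4 : ℝ≥0∞)).toReal))) ≠ ⊤ := by
  set Mr : ℝ := (K ^ (1 / (4 : ℝ))).toReal with hMr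
  have h34 : (3 / (4 : ℝ≥0∞)).toReal = 3 / 4 := by
    rw [ENNReal.toReal_div, ENNReal.toReal_ofNat, ENNReal.toReal_ofNat]
  have hexp : 2 / (1 - (3 / (4 : ℝ≥0∞)).toReal) = 8 := by rw [h34]; norm_num
  have hslice : ∀ t ∈ Ioo 0 L, (eLpNorm (u (t + s)) 4 volume).toReal ≤ Mr := by
    intro t ht
    have h4 : eLpNorm (u (t + s)) 4 volume = (∫⁻ x, ‖u (t + s) x‖ₑ ^ (4 : ℝ)) ^ (1 / (4 : ℝ)) := by
      rw [eLpNorm_eq_lintegral_rpow_enorm_toReal (by norm_num) (by norm_num), ENNReal.toReal_ofNat]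
    have hconv : ∫⁻ x, ‖u (t + s) x‖ₑ ^ (4 : ℝ) = ∫⁻ x, ENNReal.ofReal (‖u (t + s) x‖ ^ (4 : ℝ)) :=
      lintegral_congr fun x => by
        rw [← ofReal_norm, ENNReal.ofReal_rpow_of_nonneg (norm_nonneg _) (by norm_num)]
    rw [hMr, h4, hconv]
    exact ENNReal.toReal_mono (ENNReal.rpow_ne_top_of_nonneg (by norm_num) hK.ne)
      (ENNReal.rpow_le_rpow (hbd t ht) (by norm_num))
  have hMr0 : 0 ≤ Mr := ENNReal.toReal_nonneg
  rw [hexp]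
  refine ne_top_of_le_ne_top (b := ∫⁻ _ in Ioo 0 L, ENNReal.ofReal (Mr ^ (8 : ℝ))) ?_ ?_
  · rw [setLIntegral_const]
    exact ENNReal.mul_ne_top ENNReal.ofReal_ne_top (by simp [Real.volume_Ioo])
  · refine setLIntegral_mono_ae measurable_const.aemeasurable ?_
    refine Eventually.of_forall fun t ht => ENNReal.ofReal_le_ofReal ?_
    exact Real.rpow_le_rpow ENNReal.toReal_nonneg (hslice t ht) (by norm_num)

/-- **A Leray–Hopf solution with bounded `L⁴` energy near the right end `β` of an interval of
`H¹`-regularity keeps `limsup_{t → β⁻} ‖u(t)‖²_{H¹} < ∞`** (the continuation hypothesis of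
`leray_continuation_H1` at `β`; Robinson–Rodrigo–Sadowski 2016, Thm. 8.17 / Lemma 8.16 in the
Serrin class `L⁸(β − δ', β; L⁴)`; here through a restart at a good time and the proved
`limsup_eH1NormSq_lt_top_of_serrin`). The `L⁴` twin of `limsup_eH1NormSq_lt_top_of_ae_bound_near`
(`LerayHopfBoundedContinuation`). [cite: RobinsonRodrigoSadowski2016, Thm. 8.17 and Lemma 8.16 (proof)] -/
theorem limsup_eH1NormSq_lt_top_of_lfour_bound_near (hν : 0 < ν) (hLH : IsLerayHopfOn T ν 0 u₀ u)
    {α β : ℝ} (hα : 0 ≤ α) (hαβ : α < β) (hβ : β ≤ T) (hreg : IsH1RegularOn (Ioo α β) u)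
    {δ : ℝ} {K : ℝ≥0∞} (hδ : 0 < δ) (hK : K < ⊤)
    (hbd : ∀ t ∈ Ioo (β - δ) β, ∫⁻ x, ENNReal.ofReal (‖u t x‖ ^ (4 : ℝ)) ≤ K) :
    limsup (fun t => eH1NormSq (u t)) (𝓝[<] β) < ⊤ := by
  obtain ⟨c, hc, hL2⟩ := tao2011_H1_local_almost_regular_holds
  -- a good restarting time in `(max α (β - δ), β)`
  set a : ℝ := max α (β - δ) with ha
  have ha0 : 0 ≤ a := hα.trans (le_max_left _ _)
  have haβ : a < β := max_lt hαβ (by linarith)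
  obtain ⟨s, hs, hLHs⟩ := hLH.exists_isLerayHopfOn_restart_Ioo hν.le ha0 haβ hβ
  have hαs : α < s := (le_max_left _ _).trans_lt hs.1
  have hδs : β - δ < s := (le_max_right _ _).trans_lt hs.1
  -- the translate on the horizon `β - s`
  have hLHw : IsLerayHopfOn (β - s) ν 0 (u s) (fun t => u (t + s)) := hLHs.of_le (by linarith)
  have hregw : IsH1RegularOn (Ioo 0 (β - s)) (fun t => u (t + s)) := by
    have h := hreg.comp_add_right s
    exact h.mono (Ioo_subset_Ioo (by linarith) le_rfl)
  have hA := lintegral_serrin_four_ne_top_of_lfour_bound (u := u) (s := s) (L := β - s) hK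
    fun t ht => hbd (t + s) ⟨by linarith [ht.1], by linarith [ht.2]⟩
  have hlim : limsup (fun t => eH1NormSq (u (t + s))) (𝓝[<] (β - s)) < ⊤ :=
    limsup_eH1NormSq_lt_top_of_serrin hL2 hc hν hLHw (r := 4) (by norm_num) hA le_rfl
      (sub_pos.2 hs.2) le_rfl hregw
  -- translate the bound back to `β`
  set L : ℝ≥0∞ := limsup (fun t => eH1NormSq (u (t + s))) (𝓝[<] (β - s)) with hL
  have hL1 : L < L + 1 := ENNReal.lt_add_right hlim.ne one_ne_zero
  have hev : ∀ᶠ t in 𝓝[<] (β - s), eH1NormSq (u (t + s)) < L + 1 :=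
    Filter.eventually_lt_of_limsup_lt hL1
  obtain ⟨l, hl, hsub⟩ := mem_nhdsLT_iff_exists_Ioo_subset.1 hev
  have hev' : ∀ᶠ t in 𝓝[<] β, eH1NormSq (u t) ≤ L + 1 := by
    filter_upwards [Ioo_mem_nhdsLT (show l + s < β by linarith [mem_Iio.1 hl])] with t ht
    have h := hsub (show t - s ∈ Ioo l (β - s) from ⟨by linarith [ht.1], by linarith [ht.2]⟩)
    simp only [mem_setOf_eq, sub_add_cancel] at h
    exact h.le
  exact lt_of_le_of_lt (Filter.limsup_le_of_le (by isBoundedDefault) hev')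
    (ENNReal.add_lt_top.2 ⟨hlim, ENNReal.one_lt_top⟩)

end StepB

/-! ### The discharge for `1 < q < 3` -/

section Discharge

/-- **The pressure-gradient regularity criterion on `ℝ³`, case `1 < q < 3`, PROVED**
(Lemarié-Rieusset 2016, Prop. 11.7 with `σ = 2`, the half `q ∈ (1, 3)` of the range
`1 < q < ∞`; Berselli–Galdi 2002, Thm. 3.3 / Zhou: `∇p ∈ L^s_t L^q_x`, `2/s + 3/q = 3`): the body of
the named fact `Literature.Analysis.FluidPDE.pressureGradientCriterion` under the extra hypothesis
`q < 3`. Proof: every open interval of `H¹`-regularity `(α, β) ⊆ (0, T)` carries the uniform `L⁴`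
bound of `exists_lfour_le_of_pressureGradient` (the `L⁴` energy method) towards `β`, hence
`limsup_{t→β⁻}‖u‖²_{H¹} < ∞` (`limsup_eH1NormSq_lt_top_of_lfour_bound_near`, Serrin pair `(8, 4)`);
Leray's continuation (`leray_continuation_H1_holds`) makes `u` `H¹`-regular on `(0, T]`, and the
extension past `T` is Leray's local strong solution from `u(s)`, `s` a good time near `T`, made
classical by Ladyzhenskaya–Prodi–Serrin and glued by weak–strong uniqueness — verbatim as in
`BeiraoDaVeiga1995_gradientCriterion_holds`. The case `q ≥ 3` (LR's `L^θ` energy, `θ = 3q - 2`)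
is not covered here. [cite: LemarieRieusset2016, §11.5 Prop. 11.7 (PDF pp. 362–364)]
[cite: BerselliGaldi2002, Thm. 3.3 p. 3593] -/
theorem pressureGradientCriterion_of_lt_three (ν T : ℝ) (hν : 0 < ν) (hT : 0 < T)
    (u : ℝ → EuclideanSpace ℝ (Fin 3) → EuclideanSpace ℝ (Fin 3))
    (p : ℝ → EuclideanSpace ℝ (Fin 3) → ℝ)
    (hcl : IsClassicalNSSolutionOn (Ico 0 T) ν 0 u p) (hLH : IsLerayHopfOn T ν 0 (u 0) u)
    (s q : ℝ≥0∞) (h1q : 1 < q) (hq3 : q < 3) (hsq : 2 / s + 3 / q = 3)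
    (hS : MemLqLp s q (fun t x => gradient (p t) x) (Ioo 0 T)) :
    HasSmoothExtensionPast ν 0 u T := by
  obtain ⟨c, hc, hL2⟩ := tao2011_H1_local_almost_regular_holds
  obtain ⟨-, -, hstop, hs0, hsθ, -⟩ := pressureGradient_exponents h1q hq3 hsq
  obtain ⟨hA1, hLq⟩ := lintegral_ofReal_rpow_pressureGradient_lt_top h1q hq3 hsq hS (M := 1) zero_le_one
  have hA : ∫⁻ t in Ioo 0 T, ENNReal.ofReal
      ((eLpNorm (fun x => gradient (p t) x) q volume).toReal ^ s.toReal) ≠ ⊤ := by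
    rw [hsθ]
    refine ne_of_lt (lt_of_le_of_lt (le_of_eq (lintegral_congr fun t => by rw [one_mul])) hA1)
  -- `u` is `H¹`-regular on `(0, T]`
  have hregT : IsH1RegularOn (Ioc 0 T) u := by
    refine leray_continuation_H1_holds ν T hν hT (u 0) u hLH fun α β hα hαβ hβ hregI => ?_
    set t₀ : ℝ := (α + β) / 2 with ht₀
    have ht₀m : t₀ ∈ Ioo α β := ⟨by rw [ht₀]; linarith, by rw [ht₀]; linarith⟩
    have ht₀T : t₀ ∈ Icc 0 T := ⟨hα.trans ht₀m.1.le, ht₀m.2.le.trans hβ⟩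
    have hy₀ : ∫⁻ x, ENNReal.ofReal (‖u t₀ x‖ ^ (4 : ℝ)) < ⊤ :=
      lintegral_lfour_lt_top_of_eH1NormSq_lt_top (hLH.memLp t₀ ht₀T) (hregI.1 t₀ ht₀m)
    obtain ⟨K, hK, hbd⟩ := exists_lfour_le_of_pressureGradient hL2 hc hν hLH hcl h1q hq3 hsq hLq hA
      hα hβ hregI ht₀m hy₀
    exact limsup_eH1NormSq_lt_top_of_lfour_bound_near hν hLH hα hαβ hβ hregI
      (δ := β - t₀) (sub_pos.2 ht₀m.2) hK fun t ht => hbd t ⟨by linarith [ht.1], ht.2⟩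
  -- `‖u(t)‖²_{H¹} ≤ A < ∞` on `[T/2, T]`
  have hreg : IsH1RegularOn (Icc (T / 2) T) u :=
    hregT.mono fun t ht => ⟨by linarith [ht.1], ht.2⟩
  obtain ⟨A, hAtop, hAle⟩ := hreg.exists_forall_le isCompact_Icc subset_rfl
  -- Leray's lifespan for data of squared `H¹` norm `≤ a = A.toReal`
  obtain ⟨c', hc', hlocc⟩ := leray_local_strong_H1_holds
  have hLPS : ladyzhenskaya_prodi_serrin := ladyzhenskaya_prodi_serrin_holds
  set a : ℝ := A.toReal with ha
  have ha0 : 0 ≤ a := ENNReal.toReal_nonneg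
  set τ : ℝ := c' * ν ^ 3 / (a ^ 2 + 1) with hτ
  have hcν : 0 < c' * ν ^ 3 := mul_pos hc' (pow_pos hν 3)
  have hτpos : 0 < τ := div_pos hcν (by positivity)
  have hτc : a ^ 2 * τ ≤ c' * ν ^ 3 := by
    have h1 : a ^ 2 * τ = c' * ν ^ 3 * (a ^ 2 / (a ^ 2 + 1)) := by
      rw [hτ]
      ring
    rw [h1]
    exact mul_le_of_le_one_right hcν.le (div_le_one_of_le₀ (by linarith) (by positivity))
  -- a good restart time `s' ∈ (max (T/2) (T - τ/2), T)`
  set s₀ : ℝ := max (T / 2) (T - τ / 2) with hs₀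
  have hs₀0 : 0 ≤ s₀ := le_max_of_le_left (by linarith)
  have hs₀T : s₀ < T := max_lt (by linarith) (by linarith)
  obtain ⟨s', hs', hLHs⟩ := hLH.exists_isLerayHopfOn_restart_Ioo hν.le hs₀0 hs₀T le_rfl
  have hsT2 : T / 2 ≤ s' := (le_max_left _ _).trans hs'.1.le
  have hsτ : T < s' + τ := by
    have h1 : T - τ / 2 < s' := (le_max_right _ _).trans_lt hs'.1
    linarith
  have hs0 : 0 < s' := by linarith
  have hTs : 0 < T - s' := sub_pos.2 hs'.2
  have hTsτ : T - s' ≤ τ := by linarith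
  -- the datum `u s' ∈ H¹` with `‖∇u(s')‖² ≤ a`
  have hu2 : MemLp (u s') 2 volume := hLH.memLp s' ⟨hs0.le, hs'.2.le⟩
  have hdiv : IsWeaklyDivFree (u s') := hLHs.isWeaklyDivFree_datum hTs
  have hgrad : eWeakGradL2Sq (u s') ≤ ENNReal.ofReal a := by
    calc eWeakGradL2Sq (u s') ≤ eH1NormSq (u s') := le_add_self
      _ ≤ A := hAle s' ⟨hsT2, hs'.2.le⟩
      _ = ENNReal.ofReal a := (ENNReal.ofReal_toReal hAtop.ne).symm
  -- Leray's local strong solution `v` from `u s'` on `[0, τ]` (RRS Thm. 6.15)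
  obtain ⟨v, hv, hv0, hvreg⟩ := hlocc hν hτpos hu2 hdiv ha0 hgrad hτc
  -- its classical representative `(V, P)` on `(0, τ]` (RRS Thm. 8.17, first clause, `L^∞_t L⁶_x`)
  have hvS : MemLqLp ∞ 6 v (Ioo 0 τ) :=
    memLqLp_top_six_of_isH1RegularOn_Icc hvreg fun t ht => hv.memLp t ht
  have hr6 : (3 : ℝ≥0∞) < 6 := by norm_num
  have hqr6 : 2 / (∞ : ℝ≥0∞) + 3 / (6 : ℝ≥0∞) ≤ 1 := by
    rw [ENNReal.div_top, zero_add]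
    exact ENNReal.div_le_of_le_mul (by norm_num)
  obtain ⟨V, P, hVP, hvV⟩ := hLPS hν hτpos hv hr6 hqr6 hvS
  -- weak–strong uniqueness on `[0, T - s')`: `u (t + s') = v t` a.e., `0 < t ≤ T - s'`
  have hae : ∀ t ∈ Ioc 0 (T - s'), (fun t => u (t + s')) t =ᵐ[volume] v t :=
    serrin_weak_strong_uniqueness_holds hν hTs (hv.of_le hTsτ) hu2 (q := ∞) (r := 6) hr6
      hqr6 (hvS.mono_set (Ioo_subset_Ioo_right hTsτ)) hLHs
  -- everywhere agreement of the continuous slices on `(s', T)`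
  have heq : ∀ t ∈ Ioo s' T, u t = V (t + -s') := by
    intro t ht
    have hts : t - s' ∈ Ioc 0 (T - s') := ⟨sub_pos.2 ht.1, by linarith [ht.2]⟩
    have h1 : u t =ᵐ[volume] v (t - s') := by
      have h := hae (t - s') hts
      simpa only [sub_add_cancel] using h
    have h2 : v (t - s') =ᵐ[volume] V (t - s') := hvV (t - s') ⟨hts.1, hts.2.trans hTsτ⟩
    have hcu : Continuous (u t) :=
      (hcl.contDiff_velocity ⟨hs0.le.trans ht.1.le, ht.2⟩).continuous
    have hcV : Continuous (V (t - s')) :=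
      (hVP.contDiff_velocity ⟨hts.1, hts.2.trans hTsτ⟩).continuous
    rw [← sub_eq_add_neg]
    exact (Continuous.ae_eq_iff_eq volume hcu hcV).1 (h1.trans h2)
  -- the continuation piece `(V, P)(· - s')` on `(s', s' + τ)`
  have h₂ : IsClassicalNSSolutionOn (Ioo s' (s' + τ)) ν 0 (fun t => V (t + -s'))
      (fun t => P (t + -s')) := by
    have hVP' := hVP.comp_add_right (-s')
    have h0 : (fun t => (0 : ℝ → EuclideanSpace ℝ (Fin 3) → EuclideanSpace ℝ (Fin 3)) (t + -s')) = 0 :=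
      rfl
    rw [h0] at hVP'
    exact hVP'.mono (fun t ht => ⟨by simp only [mem_Ioo] at ht ⊢; linarith [ht.1],
      by simp only [mem_Ioo] at ht ⊢; linarith [ht.2]⟩) isOpen_Ioo.uniqueDiffOn
  -- glue along the overlap `(s', T)`
  exact ⟨s' + τ, hsτ, _, _, hcl.glue h₂ hs0.le hs'.2 hsτ.le heq, fun t ht => by
    simp only [if_pos ht.2]⟩

end Discharge

end Literature.Analysis.FluidPDE

end
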